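import Summits.BirchSwinnertonDyer.BirchSwinnertonDyer.Theorems.ResidualThetaTransportAtTwoThetaLayerLambdaCongruenceAtTwoCurveMuIffFlat
import Summits.BirchSwinnertonDyer.BirchSwinnertonDyer.Theorems.ResidualThetaTransportAtTwoSignedMuVanishingAtTwoPlusAnalyticChild
import HarnessLib

/-!
# Crux Kan⁺ `ThetaLayerLambdaCongruenceAtTwo` (stmt-BirchSwinnertonDyer-20688, route ResidualThetaTransportAtTwo), line `birth`:
# THE CRUX BY NAME from EIGHT NAMED PRINT FACTS + the EXISTING route item 21437 `SignedMuAnalyticAtTwoPlus` (Kμ⁺'s analytic child)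

Lead prover bsd-wall-rtt-p3 g8 (`--supports stmt-BirchSwinnertonDyer-20688`; closes nothing; THEOREMS ONLY — no `def`, no `sorry`; every
hypothesis is a Literature named fact BY NAME or a route decl BY NAME; BSD is not proved by this).

WHY THIS FILE. Three kernel facts landed independently within one hour of each other:
* p609241 (lead g7, `…CruxOfPlusSymbolMax`) + p608093/p605109: Kan⁺ ⟸ the seven plus-line facts + the research stub (μ-W₀)
  («the plus symbol of the habitat⁺ newform attains its 2-adic maximum over ℚ at an even-layer 2-power cusp»);
* p611018 (width seat w2 g2, `…CurveMuIffFlat`): (μ-W₀) ⟺ FLAT («`2 ∤ L⁻` for every Pollack pair at 2 of the habitat⁺ newform» —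
  VERBATIM the registered research stub `stub_flatMuZeroAtTwo` of the SIBLING crux Kμ⁺ `SignedMuVanishingAtTwoPlus`), and hence
  `thetaLayerLambdaCongruenceAtTwo_of_facts_flatMuZeroAtTwo_deligne` : Kan⁺ ⟸ seven facts + FLAT;
* rtt-p4's `…SignedMuVanishingAtTwoPlusAnalyticChild` (`signedMuAnalyticAtTwoPlus_iff_flatMuZero_of_abbesUllmo`,
  `flatMuZero_of_signedMuAnalyticAtTwoPlus_of_periodUnit`): GRANTED Abbes–Ullmo Thm A (the tree's Literature fact
  `abbesUllmo_not_dvd_maninConstant_of_not_dvd_level`, which yields the period-unit statement PER «Ω_W = u·Ω⁺_f, |u|₂ = 1»),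
  the route ITEM 21437 `SignedMuAnalyticAtTwoPlus` (Néron-normalised analytic μ = 0, crux r401 of this route) IS FLAT.
Composed: **Kan⁺ ⟸ {Eichler–Shimura depleted optimal quotient, Faltings, Mazur–Kenku, Hecke self-duality of J₀[2], Buzzard mod-2
multiplicity one, Serre 1972 Prop 12, Deligne Weil I, Abbes–Ullmo Thm A} + `SignedMuAnalyticAtTwoPlus`** — the crux's ENTIRE research
content is the EXISTING sibling item 21437; no new conjecture-grade item is needed to file the twin
«KanP := PUB⁸ → SignedMuAnalyticAtTwoPlus → ThetaLayerLambdaCongruenceAtTwo» (pattern KλP / K3P′), which this file closes with one term.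
Also the Abbes–Ullmo-free form with PER as an explicit hypothesis (`…_of_facts_periodUnit_signedMuAnalytic`).

References: [GreenbergVatsal2000] §1 (10), Prop. (2.4), §3 Rem. 3.4; [Pollack2003] Conj. 6.3, Prop. 6.18; [PollackWeston2011MT] §3.1,
Rem. 4.2; [AbbesUllmo1996] Thm. A; [Buzzard2000LevelLoweringModTwo] Prop. 2.4; [Deligne1974] Thm. 8.2.
-/

noncomputable section

-- justification: the `Summit.BirchSwinnertonDyer.BirchSwinnertonDyer.…` path repeats a component (route-file convention)
set_option linter.dupNamespace false

open scoped Classical MatrixGroups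

open CongruenceSubgroup Literature.NumberTheory.EllipticCurves Literature.NumberTheory.EllipticCurves.ModularForms
open Summit.BirchSwinnertonDyer.BirchSwinnertonDyer.Theses.ResidualThetaTransportAtTwo

namespace Summit.BirchSwinnertonDyer.BirchSwinnertonDyer.Theorems.ThetaLayerLambdaCongruenceAtTwo

/-- **Kan⁺ BY NAME from seven plus-line facts, the PERIOD-UNIT statement PER at `2` (inline: on the habitat the Néron period is a
`2`-adic-unit rational multiple of `Ω⁺_f`), Deligne, and the route item `SignedMuAnalyticAtTwoPlus` (21437).** PER ∧ 21437 ⟹ FLAT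
(`flatMuZero_of_signedMuAnalyticAtTwoPlus_of_periodUnit`, take `m = 0`, `G = C(ϖ)·L♭`), FLAT ⟹ Kan⁺ given the seven facts
(`thetaLayerLambdaCongruenceAtTwo_of_facts_flatMuZeroAtTwo_deligne`, through (μ-W₀) ⟺ FLAT and the v11 composition). Abbes–Ullmo-free.
BSD is not proved by this. [cite: Pollack2003, Prop. 6.18 (shape)] [cite: GreenbergVatsal2000, §3 Rem. 3.4 (shape)] -/
theorem thetaLayerLambdaCongruenceAtTwo_of_facts_periodUnit_signedMuAnalytic
    (hES : eichlerShimura_depletedOptimalQuotient_periodLattice_of_dvd)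
    (hF : WeierstrassCurve.isIsogenous_iff_frobeniusTrace_eq) (hMK : mazurKenku_exists_cyclic_isogeny)
    (hSD : heckeSelfDual_torsionBy_J0) (hBz : buzzard2000_multiplicityOne_gamma0)
    (hSe : serre1972_supersingular_decompositionSubgroup_image)
    (hD : Deligne1974_heckeT_eigenvalue_norm_le)
    (hper : ∀ (W : WeierstrassCurve ℚ) [W.IsElliptic] [W.IsGloballyMinimal],
      Literature.NumberTheory.EllipticCurves.Rank1Residual.GoodSS W 2 →
      ∀ [NeZero (W.conductorNorm ℤ)] (f : CuspForm (Gamma0 (W.conductorNorm ℤ)) 2), IsNewformOf W f →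
      ∃ u : ℚ, ‖(u : ℚ_[2])‖ = 1 ∧ W.realPeriodRat = u * plusPeriod f)
    (hμ : SignedMuAnalyticAtTwoPlus) :
    ThetaLayerLambdaCongruenceAtTwo :=
  thetaLayerLambdaCongruenceAtTwo_of_facts_flatMuZeroAtTwo_deligne hES hF hMK hSD hBz hSe
    (Summit.BirchSwinnertonDyer.BirchSwinnertonDyer.Theorems.flatMuZero_of_signedMuAnalyticAtTwoPlus_of_periodUnit hμ hper) hD

/-- **THE TWIN CLOSER. Kan⁺ `ThetaLayerLambdaCongruenceAtTwo` BY NAME from EIGHT Literature named facts — Eichler–Shimura (depleted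
optimal quotient), Faltings, Mazur–Kenku, Hecke self-duality of `J₀[2]`, Buzzard's mod-`2` multiplicity one, Serre 1972 Prop. 12,
Deligne Weil I Thm. 8.2, Abbes–Ullmo Thm. A — and the EXISTING route item 21437 `SignedMuAnalyticAtTwoPlus`** (Kμ⁺'s Néron-normalised
analytic `μ = 0` child). Granted Abbes–Ullmo, 21437 ⟺ FLAT (`signedMuAnalyticAtTwoPlus_iff_flatMuZero_of_abbesUllmo`, rtt-p4);
FLAT ⟺ (μ-W₀) (p611018, w2 g2); (μ-W₀) + seven facts ⟹ Kan⁺ (p609241/p608093/p605109). So the research content of crux r3 IS the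
research content of crux r401: one conjecture-grade node (analytic μ⁻ = 0 at 2, cohomological/Néron — the same thing modulo
Abbes–Ullmo) for both. Conditional on print facts and on an OPEN item; BSD is not proved by this.
[cite: AbbesUllmo1996, Thm. A] [cite: Pollack2003, Conj. 6.3 and Prop. 6.18 (shape)] [cite: GreenbergVatsal2000, §1 (10) (shape)] -/
theorem thetaLayerLambdaCongruenceAtTwo_of_facts_abbesUllmo_signedMuAnalytic
    (hES : eichlerShimura_depletedOptimalQuotient_periodLattice_of_dvd)
    (hF : WeierstrassCurve.isIsogenous_iff_frobeniusTrace_eq) (hMK : mazurKenku_exists_cyclic_isogeny)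
    (hSD : heckeSelfDual_torsionBy_J0) (hBz : buzzard2000_multiplicityOne_gamma0)
    (hSe : serre1972_supersingular_decompositionSubgroup_image)
    (hD : Deligne1974_heckeT_eigenvalue_norm_le)
    (hAU : abbesUllmo_not_dvd_maninConstant_of_not_dvd_level)
    (hμ : SignedMuAnalyticAtTwoPlus) :
    ThetaLayerLambdaCongruenceAtTwo :=
  thetaLayerLambdaCongruenceAtTwo_of_facts_flatMuZeroAtTwo_deligne hES hF hMK hSD hBz hSe
    ((Summit.BirchSwinnertonDyer.BirchSwinnertonDyer.Theorems.signedMuAnalyticAtTwoPlus_iff_flatMuZero_of_abbesUllmo hAU).mp hμ) hD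

/-- **Curried form for a route binder list** (the pen's twin «KanP»): the eight facts, then the item, then the crux — all BY NAME. -/
theorem kanP_of_pub_of_signedMuAnalyticAtTwoPlus :
    eichlerShimura_depletedOptimalQuotient_periodLattice_of_dvd → WeierstrassCurve.isIsogenous_iff_frobeniusTrace_eq →
    mazurKenku_exists_cyclic_isogeny → heckeSelfDual_torsionBy_J0 → buzzard2000_multiplicityOne_gamma0 →
    serre1972_supersingular_decompositionSubgroup_image → Deligne1974_heckeT_eigenvalue_norm_le →
    abbesUllmo_not_dvd_maninConstant_of_not_dvd_level → SignedMuAnalyticAtTwoPlus → ThetaLayerLambdaCongruenceAtTwo :=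
  thetaLayerLambdaCongruenceAtTwo_of_facts_abbesUllmo_signedMuAnalytic

end Summit.BirchSwinnertonDyer.BirchSwinnertonDyer.Theorems.ThetaLayerLambdaCongruenceAtTwo

end
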